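import Literature.Probability.RandomPlanarGeometry.SAWAdsorptionArchUnfolding
import HarnessLib

/-!
# Marked wall edges pushed below the wall: `Z⁺_n(a) ≤ a Σ_j (a²-1)^j Σ_{i≤2j} c_{n+i}`
# (Madras 2017, proof of Theorem 2.4, for the square lattice)

Topic `Literature/Probability/RandomPlanarGeometry` (continues `SAWAdsorptionArchUnfolding.lean` / `SAWAdsorptionUpperBound.lean`:
the half-plane walks `Zd.hpWalks n` of `ℤ²` with the wall `x₀ = 0`, `Zd.wallVisits`, `Zd.adsZ n a = Z⁺_n(a)`).

Madras 2017 (J. Phys. A 50 064003, arXiv:1606.08393), proof of Theorem 2.4 (§4.1, arXiv p. 11): «`|𝓗(ω)| ≤ 2|𝓗𝓗(ω)|`» (wall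
SITES against wall EDGES — a site reached from above can only continue along the wall; with the printed `𝓗 ∋ ω(0)` the sharp
form is `≤ 2|𝓗𝓗(ω)| + 2`, immaterial to the free energy; in the tree's convention `wallVisits` omits time `0` and the inequality
reads `v(ω) ≤ 2e(ω) + 1`, proved here), marks on the wall edges, and the
map `f` which translates every marked wall edge below the wall and joins by vertical edges: «It is not hard to see that the
function `f : S_N^{(j)} → ⋃_{n=N}^{N+2j} S_n` is one-to-one». We formalise the variant with AT MOST ONE mark per wall edge
(binomial `(1+s)^e = Σ_J s^{|J|}` instead of exponential marks), in the vertex-weight convention of the tree: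

* `Zd.wallEdges`, `Zd.wallVisits_le_two_mul_card_wallEdges_add_one` — **`v(ω) ≤ 2 e(ω) + 1`** (`Zd.wall_prev_or_next`);
* `Zd.markedList n ω J` — the image `f(ω, J)` as a vertex list (blocks `ω(k)` at its arrival depth, then at its departure
  depth), `Zd.isChain_markedList`, `Zd.nodup_markedList`, `Zd.length_markedList` (`= n + 1 + #changes`),
  `Zd.card_changes_le` (`#changes ≤ 2|J|`); decoding `Zd.reduce_markedList` and **`Zd.markedList_injective`**;
* `Zd.markedPairs`, `Zd.encode`, `Zd.encode_injOn`, **`Zd.card_markedPairs_filter_le : #S_n^{(j)} ≤ Σ_{i ≤ 2j} c_{n+i}`**;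
* **`Zd.adsZ_le_marked : Z⁺_n(a) ≤ a · Σ_{j ≤ n} (a²-1)^j · Σ_{i ≤ 2j} c_{n+i}`** for `a ≥ 1`.

The sequel `SAWAdsorptionCriticalFugacityLower.lean` turns this into `e^{κ(a)} = μ` for `a² < 1 + μ⁻²`, i.e. `a_c > 1`.
Label: CONSOLIDATION (Madras 2017, proof of Thm 2.4, d = 2, one mark per edge). Pure standard axioms.
-/

noncomputable section

open Finset Filter Topology Literature.Probability.LatticeModels SimpleGraph
open scoped BigOperators

namespace Literature.Probability.RandomPlanarGeometry.SAW.Zd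

/-! ### Wall edges; a wall site is an end of a wall edge -/

open Classical in
/-- Times `k < n` at which the step `ω(k) → ω(k+1)` runs inside the wall `x₀ = 0` (the «edges in the surface»,
Madras's `𝓗𝓗(ω)`). [cite: Madras2017, §4.1 (proof of Theorem 2.4)] -/
def wallEdges (n : ℕ) (ω : ℕ → Site 2) : Finset ℕ := (Finset.range n).filter fun k => ω k 0 = 0 ∧ ω (k + 1) 0 = 0

/-- Membership in `wallEdges`. [cite: Madras2017, §4.1 (proof of Theorem 2.4)] -/
theorem mem_wallEdges {n : ℕ} {ω : ℕ → Site 2} {k : ℕ} :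
    k ∈ wallEdges n ω ↔ k < n ∧ ω k 0 = 0 ∧ ω (k + 1) 0 = 0 := by
  classical
  rw [wallEdges, Finset.mem_filter, Finset.mem_range]

/-- There are at most `n` wall edges. [cite: Madras2017, §4.1 (proof of Theorem 2.4)] -/
theorem card_wallEdges_le (n : ℕ) (ω : ℕ → Site 2) : (wallEdges n ω).card ≤ n := by
  classical
  calc (wallEdges n ω).card ≤ (Finset.range n).card := Finset.card_le_card (Finset.filter_subset _ _)
    _ = n := Finset.card_range n

/-- If `x ~ y` and `y₀ = x₀ + 1` then `y = x + e₀`. [folklore] -/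
private theorem eq_add_e0_of_adj_height {x y : Site 2} (h : (zdGraph 2).Adj x y) (h0 : y 0 = x 0 + 1) :
    y = x + Pi.single 0 1 := by
  obtain ⟨i, hi | hi⟩ := (zdGraph_adj_iff_sub x y).1 h
  · have hc := congrFun hi 0
    simp only [Pi.sub_apply] at hc
    fin_cases i
    · rw [← sub_eq_iff_eq_add']; exact hi
    · simp at hc; omega
  · have hc := congrFun hi 0
    simp only [Pi.sub_apply] at hc
    fin_cases i
    · simp at hc; omega
    · simp at hc; omega

/-- **A wall site visited at an interior time is an end of a wall edge**: if `ω(k)` is on the wall (`0 < k < n`) then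
`ω(k-1)` or `ω(k+1)` is on the wall — arriving from above, the walk can neither go back up (self-avoidance) nor down
(the wall). [cite: Madras2017, §4.1 (proof of Theorem 2.4: «|𝓗(ω)| ≤ 2|𝓗𝓗(ω)|»)] -/
theorem wall_prev_or_next {n : ℕ} {ω : ℕ → Site 2} (hω : ω ∈ hpWalks n) {k : ℕ} (hk0 : 0 < k) (hkn : k < n)
    (hk : ω k 0 = 0) : ω (k - 1) 0 = 0 ∨ ω (k + 1) 0 = 0 := by
  obtain ⟨hs, hpos⟩ := mem_hpWalks.1 hω
  obtain ⟨-, -, hadj, hinj⟩ := mem_saws.1 hs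
  by_contra hcon
  have h1 : ω (k - 1) 0 ≠ 0 := fun h => hcon (Or.inl h)
  have h2 : ω (k + 1) 0 ≠ 0 := fun h => hcon (Or.inr h)
  -- the previous site is `ω k + e₀`
  have hp1 : ω (k - 1) 0 = ω k 0 + 1 := by
    have ha := abs_sub_le_one_of_adj (hadj (k - 1) (by omega)) 0
    rw [show k - 1 + 1 = k by omega] at ha
    have := hpos (k - 1) (by omega)
    rw [abs_le] at ha
    omega
  have hn1 : ω (k + 1) 0 = ω k 0 + 1 := by
    have ha := abs_sub_le_one_of_adj (hadj k hkn) 0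
    have := hpos (k + 1) (by omega)
    rw [abs_le] at ha
    omega
  have e1 : ω (k - 1) = ω k + Pi.single 0 1 := by
    have hA : (zdGraph 2).Adj (ω k) (ω (k - 1)) := by
      have := hadj (k - 1) (by omega); rw [show k - 1 + 1 = k by omega] at this; exact this.symm
    exact eq_add_e0_of_adj_height hA hp1
  have e2 : ω (k + 1) = ω k + Pi.single 0 1 := eq_add_e0_of_adj_height (hadj k hkn) hn1
  have := hinj (show k - 1 ∈ {i | i ≤ n} by simp; omega) (show k + 1 ∈ {i | i ≤ n} by simp; omega) (e1.trans e2.symm)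
  omega

/-- **`v(ω) ≤ 2 e(ω) + 1`**: wall visits (times `1 … n` on the wall) against wall edges — every interior visit is an end
of a wall edge, each edge has two ends, and only the final site can be an isolated visit. (Printed as «`|𝓗(ω)| ≤ 2|𝓗𝓗(ω)|`»,
arXiv p. 11; with the printed `𝓗 ∋ ω(0)` the sharp form is `≤ 2|𝓗𝓗(ω)| + 2` — immaterial to the free energy; this is the
tree-convention form.) [cite: Madras2017, §4.1 (proof of Theorem 2.4, arXiv p. 11: «|𝓗(ω)| ≤ 2|𝓗𝓗(ω)|»)] -/
theorem wallVisits_le_two_mul_card_wallEdges_add_one {n : ℕ} {ω : ℕ → Site 2} (hω : ω ∈ hpWalks n) :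
    wallVisits n ω ≤ 2 * (wallEdges n ω).card + 1 := by
  classical
  -- interior visits inject into `wallEdges × Bool`
  set I := (Finset.range n).filter (fun k => 1 ≤ k ∧ ω k 0 = 0) with hI
  have hIcard : I.card ≤ (wallEdges n ω ×ˢ (Finset.univ : Finset Bool)).card := by
    refine Finset.card_le_card_of_injOn (fun k => if ω (k - 1) 0 = 0 then (k - 1, true) else (k, false))
      (fun k hk => ?_) (fun k hk k' hk' h => ?_)
    · rw [Finset.mem_coe, hI, Finset.mem_filter, Finset.mem_range] at hk
      obtain ⟨hkn, hk1, hk0⟩ := hk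
      rw [Finset.mem_coe, Finset.mem_product]
      refine ⟨?_, Finset.mem_univ _⟩
      by_cases hprev : ω (k - 1) 0 = 0
      · simp only [hprev, if_true]
        exact mem_wallEdges.2 ⟨by omega, hprev, by rw [show k - 1 + 1 = k by omega]; exact hk0⟩
      · simp only [hprev, if_false]
        exact mem_wallEdges.2 ⟨hkn, hk0, (wall_prev_or_next hω hk1 hkn hk0).resolve_left hprev⟩
    · rw [Finset.mem_coe, hI, Finset.mem_filter] at hk hk'
      by_cases ha : ω (k - 1) 0 = 0 <;> by_cases hb : ω (k' - 1) 0 = 0 <;>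
        simp only [ha, hb, if_true, if_false, Prod.mk.injEq] at h
      · omega
      · simp at h
      · simp at h
      · exact h.1
  rw [Finset.card_product, Finset.card_univ, Fintype.card_bool] at hIcard
  -- all visits = interior visits, plus possibly the last time `n`
  have hsub : (Finset.range (n + 1)).filter (fun k => 1 ≤ k ∧ ω k 0 = 0) ⊆ insert n I := by
    intro k hk
    rw [Finset.mem_filter, Finset.mem_range] at hk
    rw [Finset.mem_insert, hI, Finset.mem_filter, Finset.mem_range]
    by_cases hkn : k = n
    · exact Or.inl hkn
    · exact Or.inr ⟨by omega, hk.2⟩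
  unfold wallVisits
  calc ((Finset.range (n + 1)).filter (fun k => 1 ≤ k ∧ ω k 0 = 0)).card ≤ (insert n I).card := Finset.card_le_card hsub
    _ ≤ I.card + 1 := Finset.card_insert_le _ _
    _ ≤ 2 * (wallEdges n ω).card + 1 := by omega

/-- **Binomial marks**: `(1+s)^{e(ω)} = Σ_{J ⊆ wall edges} s^{|J|}`. [cite: Madras2017, §4.1 (proof of Theorem 2.4)] -/
theorem add_pow_card_wallEdges (n : ℕ) (ω : ℕ → Site 2) (s : ℝ) :
    (1 + s) ^ (wallEdges n ω).card = ∑ J ∈ (wallEdges n ω).powerset, s ^ J.card := by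
  rw [add_comm, ← Finset.sum_pow_mul_eq_add_pow s 1 (wallEdges n ω)]
  simp

/-! ### The marked walk: marked wall edges pushed one unit below the wall -/

/-- The unit vector `e₀` (away from the wall). [folklore] -/
def e0 : Site 2 := Pi.single 0 1

/-- `e₀` has coordinates `(1, 0)`. [cite: Madras2017, §4.1 (proof of Theorem 2.4)] -/
@[simp] theorem e0_apply_zero : e0 0 = 1 := by simp [e0]

/-- `e₀` has coordinates `(1, 0)`. [cite: Madras2017, §4.1 (proof of Theorem 2.4)] -/
@[simp] theorem e0_apply_one : e0 1 = 0 := by simp [e0]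

/-- The point `x` pushed `t` units below (towards `x₀ = -∞`). [cite: Madras2017, §4.1 (proof of Theorem 2.4: the set E₂)] -/
def push (x : Site 2) (t : ℕ) : Site 2 := x - (t : ℤ) • e0

/-- Height of a pushed point. [folklore] -/
@[simp] private theorem push_apply_zero (x : Site 2) (t : ℕ) : push x t 0 = x 0 - t := by
  simp [push]

/-- Wall coordinate of a pushed point. [folklore] -/
@[simp] private theorem push_apply_one (x : Site 2) (t : ℕ) : push x t 1 = x 1 := by
  simp [push]

/-- `push x 0 = x`. [folklore] -/
@[simp] private theorem push_zero (x : Site 2) : push x 0 = x := by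
  simp [push]

/-- A point of `ℤ²` is determined by its two coordinates. [folklore] -/
private theorem site_ext {x y : Site 2} (h0 : x 0 = y 0) (h1 : x 1 = y 1) : x = y := by
  funext j; fin_cases j <;> assumption

/-- `push x t = push y t' ` with `t = t'` forces `x = y`. [folklore] -/
private theorem eq_of_push_eq {x y : Site 2} {t : ℕ} (h : push x t = push y t) : x = y := by
  simpa [push] using h

/-- Two pushes of the same point by different depths `≤ 1` are adjacent. [folklore] -/
private theorem adj_push_push {x : Site 2} {t t' : ℕ} (ht : t ≤ 1) (ht' : t' ≤ 1) (hne : t ≠ t') :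
    (zdGraph 2).Adj (push x t) (push x t') := by
  rw [zdGraph_adj_iff_sub]
  refine ⟨0, ?_⟩
  rcases Nat.le_one_iff_eq_zero_or_eq_one.1 ht with rfl | rfl <;>
    rcases Nat.le_one_iff_eq_zero_or_eq_one.1 ht' with rfl | rfl
  · exact absurd rfl hne
  · right; simp [push, e0]
  · left; simp [push, e0]
  · exact absurd rfl hne

/-- Translating an edge preserves adjacency. [folklore] -/
private theorem adj_push_of_adj {x y : Site 2} (h : (zdGraph 2).Adj x y) (t : ℕ) :
    (zdGraph 2).Adj (push x t) (push y t) := by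
  unfold push
  rwa [zdGraph_adj_sub_right]

/-- Depth (`0` or `1`) at which the edge `k` is drawn: `1` iff it is marked. [cite: Madras2017, §4.1 (proof of Theorem 2.4)] -/
def edgeDepth (J : Finset ℕ) (k : ℕ) : ℕ := if k ∈ J then 1 else 0

/-- Depth on arrival at the vertex `k` (the walk starts on the wall). [cite: Madras2017, §4.1 (proof of Theorem 2.4)] -/
def depthIn (J : Finset ℕ) (k : ℕ) : ℕ := if k = 0 then 0 else edgeDepth J (k - 1)

/-- Depth on departure from the vertex `k` (back at depth `0` after the last vertex `n`).
[cite: Madras2017, §4.1 (proof of Theorem 2.4)] -/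
def depthOut (n : ℕ) (J : Finset ℕ) (k : ℕ) : ℕ := if k < n then edgeDepth J k else 0

/-- `edgeDepth ≤ 1`. [cite: Madras2017, §4.1 (proof of Theorem 2.4)] -/
theorem edgeDepth_le_one (J : Finset ℕ) (k : ℕ) : edgeDepth J k ≤ 1 := by
  unfold edgeDepth; split_ifs <;> omega

/-- `depthIn ≤ 1`. [cite: Madras2017, §4.1 (proof of Theorem 2.4)] -/
theorem depthIn_le_one (J : Finset ℕ) (k : ℕ) : depthIn J k ≤ 1 := by
  unfold depthIn; split_ifs; · omega
  · exact edgeDepth_le_one J _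

/-- `depthOut ≤ 1`. [cite: Madras2017, §4.1 (proof of Theorem 2.4)] -/
theorem depthOut_le_one (n : ℕ) (J : Finset ℕ) (k : ℕ) : depthOut n J k ≤ 1 := by
  unfold depthOut; split_ifs
  · exact edgeDepth_le_one J _
  · omega

/-- The departure depth at `k < n` is the arrival depth at `k+1`. [cite: Madras2017, §4.1 (proof of Theorem 2.4)] -/
theorem depthIn_succ {n : ℕ} (J : Finset ℕ) {k : ℕ} (hk : k < n) : depthIn J (k + 1) = depthOut n J k := by
  simp [depthIn, depthOut, hk]

/-- A marked edge starts on the wall. [cite: Madras2017, §4.1 (proof of Theorem 2.4)] -/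
theorem wall_of_depthOut_eq_one {n : ℕ} {ω : ℕ → Site 2} {J : Finset ℕ} (hJ : J ⊆ wallEdges n ω) {k : ℕ}
    (h : depthOut n J k = 1) : ω k 0 = 0 := by
  unfold depthOut edgeDepth at h
  by_cases hk : k < n
  · rw [if_pos hk] at h
    by_cases hJk : k ∈ J
    · exact (mem_wallEdges.1 (hJ hJk)).2.1
    · rw [if_neg hJk] at h; omega
  · rw [if_neg hk] at h; omega

/-- A marked edge ends on the wall. [cite: Madras2017, §4.1 (proof of Theorem 2.4)] -/
theorem wall_of_depthIn_eq_one {n : ℕ} {ω : ℕ → Site 2} {J : Finset ℕ} (hJ : J ⊆ wallEdges n ω) {k : ℕ}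
    (h : depthIn J k = 1) : ω k 0 = 0 := by
  unfold depthIn edgeDepth at h
  by_cases hk : k = 0
  · rw [if_pos hk] at h; omega
  · rw [if_neg hk] at h
    by_cases hJk : k - 1 ∈ J
    · have := (mem_wallEdges.1 (hJ hJk)).2.2
      rwa [show k - 1 + 1 = k by omega] at this
    · rw [if_neg hJk] at h; omega

/-- The vertices drawn at the original vertex `k`: `ω(k)` at its arrival depth, then (if different) at its departure
depth — the vertical joining edge. [cite: Madras2017, §4.1 (proof of Theorem 2.4: «all of whose remaining edges are parallel to ±u⁽¹⁾»)] -/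
def block (n : ℕ) (ω : ℕ → Site 2) (J : Finset ℕ) (k : ℕ) : List (Site 2) :=
  if depthIn J k = depthOut n J k then [push (ω k) (depthIn J k)]
  else [push (ω k) (depthIn J k), push (ω k) (depthOut n J k)]

/-- **The marked walk `f(ω, J)`** as a vertex list: the blocks of the vertices `0, …, n` in order.
[cite: Madras2017, §4.1 (proof of Theorem 2.4: the map f)] -/
def markedList (n : ℕ) (ω : ℕ → Site 2) (J : Finset ℕ) : List (Site 2) :=
  (List.range (n + 1)).flatMap (block n ω J)

section Block

variable {n : ℕ} {ω : ℕ → Site 2} {J : Finset ℕ}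

/-- Blocks are nonempty. [cite: Madras2017, §4.1 (proof of Theorem 2.4)] -/
theorem block_ne_nil (k : ℕ) : block n ω J k ≠ [] := by
  unfold block; split_ifs <;> simp

/-- The first vertex of a block. [cite: Madras2017, §4.1 (proof of Theorem 2.4)] -/
theorem head?_block (k : ℕ) : (block n ω J k).head? = some (push (ω k) (depthIn J k)) := by
  unfold block; split_ifs <;> rfl

/-- The last vertex of a block. [cite: Madras2017, §4.1 (proof of Theorem 2.4)] -/
theorem getLast?_block (k : ℕ) : (block n ω J k).getLast? = some (push (ω k) (depthOut n J k)) := by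
  unfold block; split_ifs with h
  · rw [h]; rfl
  · rfl

/-- The length of a block: `1`, or `2` at a change of depth. [cite: Madras2017, §4.1 (proof of Theorem 2.4)] -/
theorem length_block (k : ℕ) :
    (block n ω J k).length = if depthIn J k = depthOut n J k then 1 else 2 := by
  unfold block; split_ifs <;> rfl

/-- Members of a block are `ω(k)` pushed by a depth `t ≤ 1`, and `t = 1` only at a wall vertex.
[cite: Madras2017, §4.1 (proof of Theorem 2.4)] -/
theorem mem_block (hJ : J ⊆ wallEdges n ω) {k : ℕ} {z : Site 2} (hz : z ∈ block n ω J k) :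
    ∃ t, t ≤ 1 ∧ (t = 1 → ω k 0 = 0) ∧ z = push (ω k) t := by
  unfold block at hz
  split_ifs at hz with h
  · rw [List.mem_singleton] at hz
    exact ⟨_, depthIn_le_one J k, wall_of_depthIn_eq_one hJ, hz⟩
  · rcases List.mem_cons.1 hz with hz | hz
    · exact ⟨_, depthIn_le_one J k, wall_of_depthIn_eq_one hJ, hz⟩
    · rw [List.mem_singleton] at hz
      exact ⟨_, depthOut_le_one n J k, wall_of_depthOut_eq_one hJ, hz⟩

/-- A block is a chain (its one possible edge is vertical). [cite: Madras2017, §4.1 (proof of Theorem 2.4)] -/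
theorem isChain_block (k : ℕ) : (block n ω J k).IsChain (zdGraph 2).Adj := by
  unfold block; split_ifs with h
  · exact List.isChain_singleton _
  · exact List.isChain_cons_cons.2 ⟨adj_push_push (depthIn_le_one J k) (depthOut_le_one n J k) h,
      List.isChain_singleton _⟩

/-- A block has no repeated vertex. [cite: Madras2017, §4.1 (proof of Theorem 2.4)] -/
theorem nodup_block (k : ℕ) : (block n ω J k).Nodup := by
  unfold block; split_ifs with h
  · exact List.nodup_singleton _
  · refine List.nodup_cons.2 ⟨?_, List.nodup_singleton _⟩
    rw [List.mem_singleton]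
    intro heq
    have := congrFun heq 0
    simp only [push_apply_zero] at this
    omega

/-- Pushed copies of distinct vertices of a half-plane walk are distinct (a pushed wall vertex has height `-1`).
[cite: Madras2017, §4.1 (proof of Theorem 2.4: «f is one-to-one»)] -/
theorem push_ne_push (hω : ω ∈ hpWalks n) {k k' t t' : ℕ} (hk : k ≤ n) (hk' : k' ≤ n) (hkk : k ≠ k')
    (ht : t ≤ 1) (ht1 : t = 1 → ω k 0 = 0) (ht' : t' ≤ 1) (ht1' : t' = 1 → ω k' 0 = 0) :
    push (ω k) t ≠ push (ω k') t' := by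
  obtain ⟨hs, hpos⟩ := mem_hpWalks.1 hω
  intro heq
  have h0 := congrFun heq 0
  simp only [push_apply_zero] at h0
  rcases Nat.le_one_iff_eq_zero_or_eq_one.1 ht with rfl | rfl <;>
    rcases Nat.le_one_iff_eq_zero_or_eq_one.1 ht' with rfl | rfl
  · exact hkk ((mem_saws.1 hs).2.2.2 hk hk' (eq_of_push_eq heq))
  · have := hpos k hk; have := ht1' rfl; push_cast at h0; omega
  · have := hpos k' hk'; have := ht1 rfl; push_cast at h0; omega
  · exact hkk ((mem_saws.1 hs).2.2.2 hk hk' (eq_of_push_eq heq))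

/-- Distinct blocks are disjoint. [cite: Madras2017, §4.1 (proof of Theorem 2.4: «f is one-to-one»)] -/
theorem disjoint_block (hω : ω ∈ hpWalks n) (hJ : J ⊆ wallEdges n ω) {k k' : ℕ} (hk : k ≤ n) (hk' : k' ≤ n)
    (hkk : k ≠ k') : List.Disjoint (block n ω J k) (block n ω J k') := by
  intro z hz hz'
  obtain ⟨t, ht, ht1, rfl⟩ := mem_block hJ hz
  obtain ⟨t', ht', ht1', heq⟩ := mem_block hJ hz'
  exact push_ne_push hω hk hk' hkk ht ht1 ht' ht1' heq

end Block

section Marked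

variable {n : ℕ} {ω : ℕ → Site 2} {J : Finset ℕ}

/-- Gluing the blocks `0 … m` (`m ≤ n`): a chain ending at `ω(m)` pushed by its departure depth. [cite: Madras2017, §4.1 (proof of Theorem 2.4)] -/
theorem isChain_flatMap_block (hω : ω ∈ hpWalks n) :
    ∀ m ≤ n, ((List.range (m + 1)).flatMap (block n ω J)).IsChain (zdGraph 2).Adj ∧
      ((List.range (m + 1)).flatMap (block n ω J)).getLast? = some (push (ω m) (depthOut n J m))
  | 0, _ => by simp [isChain_block, getLast?_block]
  | m + 1, hm => by
    obtain ⟨ih1, ih2⟩ := isChain_flatMap_block hω m (by omega)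
    rw [List.range_succ, List.flatMap_append, List.flatMap_singleton]
    refine ⟨List.IsChain.append ih1 (isChain_block (m + 1)) fun z hz y hy => ?_, ?_⟩
    · rw [head?_block, Option.mem_def, Option.some.injEq] at hy
      rw [ih2, Option.mem_def, Option.some.injEq] at hz
      subst hy; subst hz
      rw [depthIn_succ J (show m < n by omega)]
      exact adj_push_of_adj ((mem_saws.1 (mem_hpWalks.1 hω).1).2.2.1 m (by omega)) _
    · rw [List.getLast?_append, getLast?_block, Option.some_or]

/-- **The marked walk is a nearest-neighbour chain.** [cite: Madras2017, §4.1 (proof of Theorem 2.4)] -/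
theorem isChain_markedList (hω : ω ∈ hpWalks n) : (markedList n ω J).IsChain (zdGraph 2).Adj :=
  (isChain_flatMap_block hω n le_rfl).1

/-- **The marked walk is self-avoiding.** [cite: Madras2017, §4.1 (proof of Theorem 2.4)] -/
theorem nodup_markedList (hω : ω ∈ hpWalks n) (hJ : J ⊆ wallEdges n ω) : (markedList n ω J).Nodup := by
  rw [markedList, List.nodup_flatMap]
  refine ⟨fun k _ => nodup_block k, ?_⟩
  exact List.pairwise_lt_range.imp_of_mem fun {k k'} hk hk' hlt =>
    disjoint_block hω hJ (Nat.le_of_lt_succ (List.mem_range.1 hk)) (Nat.le_of_lt_succ (List.mem_range.1 hk')) hlt.ne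

/-- The marked walk starts at `ω(0)`. [cite: Madras2017, §4.1 (proof of Theorem 2.4)] -/
theorem head?_markedList : (markedList n ω J).head? = some (ω 0) := by
  rw [markedList, List.range_succ_eq_map, List.flatMap_cons, List.head?_append, head?_block, Option.some_or]
  simp [depthIn]

/-- The marked walk is nonempty. [cite: Madras2017, §4.1 (proof of Theorem 2.4)] -/
theorem markedList_ne_nil : markedList n ω J ≠ [] := by
  intro h
  have := head?_markedList (n := n) (ω := ω) (J := J)
  rw [h] at this
  exact absurd this (by simp)

/-- The times `k ≤ n` at which the depth changes. [folklore] -/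
def changes (n : ℕ) (J : Finset ℕ) : Finset ℕ := (Finset.range (n + 1)).filter fun k => depthIn J k ≠ depthOut n J k

/-- Length of the glued blocks `0 … m`: `m + 1 +` the number of depth changes so far. [cite: Madras2017, §4.1 (proof of Theorem 2.4)] -/
theorem length_flatMap_block : ∀ m : ℕ, ((List.range (m + 1)).flatMap (block n ω J)).length =
    m + 1 + ((Finset.range (m + 1)).filter fun k => depthIn J k ≠ depthOut n J k).card
  | 0 => by
    classical
    simp only [zero_add, List.range_one, List.flatMap_cons, List.flatMap_nil, List.append_nil, length_block,
      Finset.range_one]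
    by_cases h : depthIn J 0 = depthOut n J 0
    · rw [if_pos h, Finset.filter_singleton, if_neg (not_not.2 h), Finset.card_empty]
    · rw [if_neg h, Finset.filter_singleton, if_pos h, Finset.card_singleton]
  | m + 1 => by
    classical
    rw [List.range_succ, List.flatMap_append, List.flatMap_singleton, List.length_append, length_flatMap_block m,
      Finset.range_add_one (n := m + 1), Finset.filter_insert, length_block]
    have hnot : m + 1 ∉ (Finset.range (m + 1)).filter (fun k => depthIn J k ≠ depthOut n J k) := by simp
    by_cases h : depthIn J (m + 1) = depthOut n J (m + 1)
    · rw [if_pos h, if_neg (not_not.2 h)]; omega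
    · rw [if_neg h, if_pos h, Finset.card_insert_of_notMem hnot]; omega

/-- **Length of the marked walk**: `n + 1 +` the number of depth changes.
[cite: Madras2017, §4.1 (proof of Theorem 2.4: «adding at most 2j edges»)] -/
theorem length_markedList : (markedList n ω J).length = n + 1 + (changes n J).card :=
  length_flatMap_block n

/-- **At most `2|J|` depth changes** (each change is next to a marked edge, on a definite side).
[cite: Madras2017, §4.1 (proof of Theorem 2.4: «adding at most 2j edges»)] -/
theorem card_changes_le : (changes n J).card ≤ 2 * J.card := by
  classical
  have h : (changes n J).card ≤ (J ×ˢ (Finset.univ : Finset Bool)).card := by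
    refine Finset.card_le_card_of_injOn (fun k => if depthIn J k = 1 then (k - 1, true) else (k, false))
      (fun k hk => ?_) (fun k hk k' hk' hkk => ?_)
    · rw [Finset.mem_coe, changes, Finset.mem_filter, Finset.mem_range] at hk
      obtain ⟨hkn, hch⟩ := hk
      rw [Finset.mem_coe, Finset.mem_product]
      refine ⟨?_, Finset.mem_univ _⟩
      by_cases h1 : depthIn J k = 1
      · simp only [h1, if_true]
        unfold depthIn edgeDepth at h1
        by_cases hk0 : k = 0
        · rw [if_pos hk0] at h1; omega
        · rw [if_neg hk0] at h1
          by_cases hJk : k - 1 ∈ J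
          · exact hJk
          · rw [if_neg hJk] at h1; omega
      · simp only [h1, if_false]
        have hout : depthOut n J k = 1 := by have := depthOut_le_one n J k; have := depthIn_le_one J k; omega
        unfold depthOut edgeDepth at hout
        by_cases hkn' : k < n
        · rw [if_pos hkn'] at hout
          by_cases hJk : k ∈ J
          · exact hJk
          · rw [if_neg hJk] at hout; omega
        · rw [if_neg hkn'] at hout; omega
    · rw [Finset.mem_coe, changes, Finset.mem_filter] at hk hk'
      by_cases ha : depthIn J k = 1 <;> by_cases hb : depthIn J k' = 1 <;>
        simp only [ha, hb, if_true, if_false, Prod.mk.injEq] at hkk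
      · have hk0 : k ≠ 0 := by intro h0; simp [depthIn, h0] at ha
        have hk0' : k' ≠ 0 := by intro h0; simp [depthIn, h0] at hb
        omega
      · simp at hkk
      · simp at hkk
      · exact hkk.1
  rw [Finset.card_product, Finset.card_univ, Fintype.card_bool] at h
  omega

end Marked

/-! ### Decoding: delete the inserted vertical edges -/

/-- An inserted vertical edge: between a wall vertex (height `0`) and its pushed copy (height `-1`).
[cite: Madras2017, §4.1 (proof of Theorem 2.4: «all of whose remaining edges are parallel to ±u⁽¹⁾»)] -/
def IsIns (x y : Site 2) : Prop := (y = push x 1 ∧ y 0 = -1) ∨ (x = push y 1 ∧ x 0 = -1)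

/-- `IsIns` is decidable. [folklore] -/
instance (x y : Site 2) : Decidable (IsIns x y) := inferInstanceAs (Decidable (_ ∨ _))

/-- Delete the first endpoint of every inserted vertical edge. [folklore] -/
def reduce : List (Site 2) → List (Site 2)
  | [] => []
  | [x] => [x]
  | x :: y :: t => if IsIns x y then reduce (y :: t) else x :: reduce (y :: t)

section Decode

variable {n : ℕ} {ω : ℕ → Site 2} {J : Finset ℕ}

/-- The vertical edge inside a block is an inserted edge. [cite: Madras2017, §4.1 (proof of Theorem 2.4)] -/
theorem isIns_push_push (hJ : J ⊆ wallEdges n ω) {k : ℕ} (h : depthIn J k ≠ depthOut n J k) :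
    IsIns (push (ω k) (depthIn J k)) (push (ω k) (depthOut n J k)) := by
  have h1 := depthIn_le_one J k
  have h2 := depthOut_le_one n J k
  rcases Nat.le_one_iff_eq_zero_or_eq_one.1 h1 with ha | ha <;>
    rcases Nat.le_one_iff_eq_zero_or_eq_one.1 h2 with hb | hb
  · exact absurd (ha.trans hb.symm) h
  · left
    rw [ha, hb, push_zero]
    exact ⟨rfl, by rw [push_apply_zero, wall_of_depthOut_eq_one hJ hb]; norm_num⟩
  · right
    rw [ha, hb, push_zero]
    exact ⟨rfl, by rw [push_apply_zero, wall_of_depthIn_eq_one hJ ha]; norm_num⟩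
  · exact absurd (ha.trans hb.symm) h

/-- A translated original edge is NOT an inserted edge: at depth `1` it is horizontal (both ends on the wall), at depth
`0` it does not reach height `-1`. [cite: Madras2017, §4.1 (proof of Theorem 2.4)] -/
theorem not_isIns_step (hω : ω ∈ hpWalks n) (hJ : J ⊆ wallEdges n ω) {k : ℕ} (hk : k < n) :
    ¬ IsIns (push (ω k) (depthOut n J k)) (push (ω (k + 1)) (depthOut n J k)) := by
  obtain ⟨hs, hpos⟩ := mem_hpWalks.1 hω
  have hd : depthOut n J k = edgeDepth J k := by simp [depthOut, hk]
  intro hins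
  rcases Nat.le_one_iff_eq_zero_or_eq_one.1 (depthOut_le_one n J k) with h0 | h1
  · -- depth 0: no endpoint at height -1
    rw [h0, push_zero, push_zero] at hins
    rcases hins with ⟨-, hy⟩ | ⟨-, hx⟩
    · have := hpos (k + 1) (by omega); omega
    · have := hpos k hk.le; omega
  · -- depth 1: the edge lies in the wall, so it is horizontal
    have hkJ : k ∈ J := by
      rw [hd] at h1; unfold edgeDepth at h1; by_contra hc; rw [if_neg hc] at h1; omega
    obtain ⟨-, hw0, hw1⟩ := mem_wallEdges.1 (hJ hkJ)
    rw [h1] at hins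
    rcases hins with ⟨he, -⟩ | ⟨he, -⟩
    · have := congrFun he 0
      simp only [push_apply_zero] at this
      omega
    · have := congrFun he 0
      simp only [push_apply_zero] at this
      omega

/-- **Decoding the marked walk**: deleting the inserted vertical edges leaves `ω(0), …, ω(n)`, each pushed by its
departure depth (so `ω` and `J` can be read off). [cite: Madras2017, §4.1 (proof of Theorem 2.4: «the function f … is one-to-one»)] -/
theorem reduce_flatMap_block (hω : ω ∈ hpWalks n) (hJ : J ⊆ wallEdges n ω) :
    ∀ m k : ℕ, k + m = n →
      reduce ((List.range' k (m + 1)).flatMap (block n ω J)) =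
        (List.range' k (m + 1)).map fun j => push (ω j) (depthOut n J j)
  | 0, k, hk => by
    rw [zero_add, List.range'_one, List.flatMap_cons, List.flatMap_nil, List.append_nil, List.map_singleton]
    unfold block
    split_ifs with h
    · rw [h]; rfl
    · rw [reduce, if_pos (isIns_push_push hJ h)]; rfl
  | m + 1, k, hk => by
    have ih := reduce_flatMap_block hω hJ m (k + 1) (by omega)
    have hkn : k < n := by omega
    rw [List.range'_succ, List.flatMap_cons, List.map_cons]
    -- the rest starts with `ω(k+1)` at its arrival depth `= depthOut k`
    obtain ⟨rest, hrest⟩ : ∃ rest, (List.range' (k + 1) (m + 1)).flatMap (block n ω J) =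
        push (ω (k + 1)) (depthOut n J k) :: rest := by
      rw [List.range'_succ, List.flatMap_cons]
      refine ⟨(block n ω J (k + 1)).tail ++ (List.range' (k + 1 + 1) m).flatMap (block n ω J), ?_⟩
      rw [← List.cons_append]
      congr 1
      rw [← depthIn_succ J hkn]
      unfold block; split_ifs <;> rfl
    rw [hrest] at ih ⊢
    have hstep := not_isIns_step hω hJ hkn
    unfold block
    split_ifs with h
    · rw [List.singleton_append, reduce, if_neg (by rwa [h]), ih, h]
    · rw [List.cons_append, List.singleton_append, reduce, if_pos (isIns_push_push hJ h), reduce, if_neg hstep, ih]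

/-- **Decoding**: `reduce (markedList ω J) = [ω(0) ↓ d₀, …, ω(n) ↓ d_n]`, `d_k` the departure depths.
[cite: Madras2017, §4.1 (proof of Theorem 2.4: «the function f … is one-to-one»)] -/
theorem reduce_markedList (hω : ω ∈ hpWalks n) (hJ : J ⊆ wallEdges n ω) :
    reduce (markedList n ω J) = (List.range (n + 1)).map fun j => push (ω j) (depthOut n J j) := by
  rw [markedList, List.range_eq_range']
  exact reduce_flatMap_block hω hJ n 0 (by omega)

/-- **The marking map `(ω, J) ↦ f(ω, J)` is injective** on half-plane walks with marked wall edges.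
[cite: Madras2017, §4.1 (proof of Theorem 2.4: «the function f … is one-to-one»)] -/
theorem markedList_injective {ω ω' : ℕ → Site 2} {J J' : Finset ℕ} (hω : ω ∈ hpWalks n) (hω' : ω' ∈ hpWalks n)
    (hJ : J ⊆ wallEdges n ω) (hJ' : J' ⊆ wallEdges n ω') (h : markedList n ω J = markedList n ω' J') :
    ω = ω' ∧ J = J' := by
  have hred := congrArg reduce h
  rw [reduce_markedList hω hJ, reduce_markedList hω' hJ'] at hred
  have hpt : ∀ j ≤ n, push (ω j) (depthOut n J j) = push (ω' j) (depthOut n J' j) := by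
    intro j hj
    have := congrArg (fun l : List (Site 2) => l[j]?) hred
    simpa [List.getElem?_map, List.getElem?_range, Nat.lt_succ_of_le hj] using this
  -- depths agree (a pushed wall vertex has height -1, an unpushed one height ≥ 0), hence the points agree
  have hdep : ∀ j ≤ n, depthOut n J j = depthOut n J' j ∧ ω j = ω' j := by
    intro j hj
    have he := hpt j hj
    have h0 := congrFun he 0
    simp only [push_apply_zero] at h0
    have hp := (mem_hpWalks.1 hω).2 j hj
    have hp' := (mem_hpWalks.1 hω').2 j hj
    rcases Nat.le_one_iff_eq_zero_or_eq_one.1 (depthOut_le_one n J j) with ha | ha <;>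
      rcases Nat.le_one_iff_eq_zero_or_eq_one.1 (depthOut_le_one n J' j) with hb | hb
    · rw [ha, hb] at he; exact ⟨ha.trans hb.symm, eq_of_push_eq he⟩
    · have := wall_of_depthOut_eq_one hJ' hb; rw [ha, hb] at h0; push_cast at h0; omega
    · have := wall_of_depthOut_eq_one hJ ha; rw [ha, hb] at h0; push_cast at h0; omega
    · rw [ha, hb] at he; exact ⟨ha.trans hb.symm, eq_of_push_eq he⟩
  refine ⟨?_, ?_⟩
  · obtain ⟨-, hend, -, -⟩ := mem_saws.1 (mem_hpWalks.1 hω).1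
    obtain ⟨-, hend', -, -⟩ := mem_saws.1 (mem_hpWalks.1 hω').1
    funext i
    rcases le_or_gt i n with hi | hi
    · exact (hdep i hi).2
    · rw [hend i hi.le, hend' i hi.le, (hdep n le_rfl).2]
  · ext j
    rcases lt_or_ge j n with hj | hj
    · have hd := (hdep j hj.le).1
      simp only [depthOut, hj, if_true, edgeDepth] at hd
      by_cases h1 : j ∈ J <;> by_cases h2 : j ∈ J' <;> simp [h1, h2] at hd ⊢
    · constructor
      · intro h1; have := (mem_wallEdges.1 (hJ h1)).1; omega
      · intro h2; have := (mem_wallEdges.1 (hJ' h2)).1; omega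

end Decode

/-! ### From vertex lists to `saws`, and the count of marked pairs -/

/-- The vertex function of a vertex list, frozen at the last vertex. [folklore] -/
def ofList (l : List (Site 2)) (s : ℕ) : Site 2 := (l[s]?).getD (l.getLast?.getD 0)

/-- `ofList l s = l[s]` inside the list. [folklore] -/
private theorem ofList_eq_getElem {l : List (Site 2)} {s : ℕ} (hs : s < l.length) : ofList l s = l[s] := by
  simp [ofList, List.getElem?_eq_getElem hs]

/-- `ofList l s` is the last vertex from the last index on. [folklore] -/
private theorem ofList_eq_getLast {l : List (Site 2)} (hl : l ≠ []) {s : ℕ} (hs : l.length - 1 ≤ s) :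
    ofList l s = l.getLast hl := by
  rcases lt_or_ge s l.length with h | h
  · rw [ofList_eq_getElem h, List.getLast_eq_getElem]
    congr 1; omega
  · simp [ofList, List.getElem?_eq_none h, List.getLast?_eq_getLast_of_ne_nil hl]

/-- A duplicate-free nearest-neighbour vertex list from `0`, read as a vertex function, is a walk of `saws`. [folklore] -/
private theorem ofList_mem_saws {l : List (Site 2)} (hl : l ≠ []) (hN : l.Nodup)
    (hC : l.IsChain (zdGraph 2).Adj) (h0 : l.head? = some 0) : ofList l ∈ saws 2 (l.length - 1) := by
  have hlen : 0 < l.length := List.length_pos_of_ne_nil hl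
  have hp' : l[0] = 0 := by
    rw [← List.head_eq_getElem hl]; exact Option.some.inj ((List.head?_eq_some_head hl).symm.trans h0)
  rw [mem_saws]
  refine ⟨?_, ?_, ?_, ?_⟩
  · rw [ofList_eq_getElem hlen, hp']
  · intro i hi
    rw [ofList_eq_getLast hl hi, ofList_eq_getLast hl le_rfl]
  · intro i hi
    rw [ofList_eq_getElem (by omega), ofList_eq_getElem (by omega)]
    exact List.isChain_iff_getElem.1 hC i (by omega)
  · intro i hi j hj hij
    simp only [Set.mem_setOf_eq] at hi hj
    rw [ofList_eq_getElem (by omega), ofList_eq_getElem (by omega)] at hij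
    exact (hN.getElem_inj_iff).1 hij

/-- Two lists of the same length with the same vertex function are equal. [folklore] -/
private theorem ofList_inj {l l' : List (Site 2)} (hlen : l.length = l'.length)
    (h : ofList l = ofList l') : l = l' :=
  List.ext_getElem hlen fun i h1 h2 => by
    rw [← ofList_eq_getElem h1, ← ofList_eq_getElem h2, h]

/-- A vertex function belongs to at most one `saws d m`. [folklore] -/
private theorem eq_of_mem_saws_of_mem_saws {d m m' : ℕ} {υ : ℕ → Site d} (h : υ ∈ saws d m)
    (h' : υ ∈ saws d m') : m = m' := by
  obtain ⟨-, he, -, hi⟩ := mem_saws.1 h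
  obtain ⟨-, he', -, hi'⟩ := mem_saws.1 h'
  by_contra hne
  rcases lt_or_gt_of_ne hne with hlt | hlt
  · have := hi' (show m ≤ m' by omega) (show m + 1 ≤ m' by omega) (he (m + 1) (by omega)).symm
    omega
  · have := hi (show m' ≤ m by omega) (show m' + 1 ≤ m by omega) (he' (m' + 1) (by omega)).symm
    omega

/-- **Marked pairs**: a half-plane walk together with a set of marked wall edges.
[cite: Madras2017, §4.1 (proof of Theorem 2.4: marked walks S_N^{(j)})] -/
def markedPairs (n : ℕ) : Finset (Σ _ : ℕ → Site 2, Finset ℕ) := (hpWalks n).sigma fun ω => (wallEdges n ω).powerset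

/-- Membership in `markedPairs`. [cite: Madras2017, §4.1 (proof of Theorem 2.4)] -/
theorem mem_markedPairs {n : ℕ} {p : Σ _ : ℕ → Site 2, Finset ℕ} :
    p ∈ markedPairs n ↔ p.1 ∈ hpWalks n ∧ p.2 ⊆ wallEdges n p.1 := by
  rw [markedPairs, Finset.mem_sigma, Finset.mem_powerset]

/-- **The encoding `f`**: the marked walk as a vertex function. [cite: Madras2017, §4.1 (proof of Theorem 2.4: the map f)] -/
def encode (n : ℕ) (p : Σ _ : ℕ → Site 2, Finset ℕ) : ℕ → Site 2 := ofList (markedList n p.1 p.2)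

/-- `f(ω, J)` is a self-avoiding walk of `n + #changes` steps. [cite: Madras2017, §4.1 (proof of Theorem 2.4)] -/
theorem encode_mem_saws {n : ℕ} {p : Σ _ : ℕ → Site 2, Finset ℕ} (hp : p ∈ markedPairs n) :
    encode n p ∈ saws 2 (n + (changes n p.2).card) := by
  obtain ⟨hω, hJ⟩ := mem_markedPairs.1 hp
  have h0 : p.1 0 = 0 := (mem_saws.1 (mem_hpWalks.1 hω).1).1
  have h := ofList_mem_saws (markedList_ne_nil (n := n) (ω := p.1) (J := p.2)) (nodup_markedList hω hJ)
    (isChain_markedList hω) (by rw [head?_markedList, h0])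
  rwa [length_markedList, show n + 1 + (changes n p.2).card - 1 = n + (changes n p.2).card by omega] at h

/-- **`f` is injective on marked pairs.** [cite: Madras2017, §4.1 (proof of Theorem 2.4: «f … is one-to-one»)] -/
theorem encode_injOn (n : ℕ) : Set.InjOn (encode n) ↑(markedPairs n) := by
  intro p hp q hq h
  obtain ⟨hω, hJ⟩ := mem_markedPairs.1 (Finset.mem_coe.1 hp)
  obtain ⟨hω', hJ'⟩ := mem_markedPairs.1 (Finset.mem_coe.1 hq)
  have hlen : (markedList n p.1 p.2).length = (markedList n q.1 q.2).length := by
    have h1 := encode_mem_saws hp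
    have h2 := encode_mem_saws hq
    rw [h] at h1
    have := eq_of_mem_saws_of_mem_saws h1 h2
    rw [length_markedList, length_markedList]; omega
  obtain ⟨h1, h2⟩ := markedList_injective hω hω' hJ hJ' (ofList_inj hlen h)
  rcases p with ⟨ω, J⟩; rcases q with ⟨ω', J'⟩
  simp only at h1 h2
  subst h1; subst h2; rfl

/-- **`|S_n^{(j)}| ≤ Σ_{i ≤ 2j} c_{n+i}`**: marked pairs with `j` marks inject into the walks of lengths `n, …, n+2j`.
[cite: Madras2017, §4.1 (proof of Theorem 2.4: «|S_N^{(j)}| ≤ A(μ+ε)^{N+2j}»)] -/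
theorem card_markedPairs_filter_le (n j : ℕ) :
    ((markedPairs n).filter fun p => p.2.card = j).card ≤ ∑ i ∈ Finset.range (2 * j + 1), count 2 (n + i) := by
  classical
  calc ((markedPairs n).filter fun p => p.2.card = j).card
      ≤ ((Finset.range (2 * j + 1)).biUnion fun i => saws 2 (n + i)).card := by
        refine Finset.card_le_card_of_injOn (encode n) (fun p hp => ?_) fun p hp q hq h =>
          encode_injOn n (Finset.mem_coe.2 (Finset.mem_filter.1 (Finset.mem_coe.1 hp)).1)
            (Finset.mem_coe.2 (Finset.mem_filter.1 (Finset.mem_coe.1 hq)).1) h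
        obtain ⟨hp, hj⟩ := Finset.mem_filter.1 (Finset.mem_coe.1 hp)
        rw [Finset.mem_coe, Finset.mem_biUnion]
        refine ⟨(changes n p.2).card, Finset.mem_range.2 ?_, encode_mem_saws hp⟩
        have := card_changes_le (n := n) (J := p.2)
        omega
    _ ≤ ∑ i ∈ Finset.range (2 * j + 1), (saws 2 (n + i)).card := Finset.card_biUnion_le
    _ = ∑ i ∈ Finset.range (2 * j + 1), count 2 (n + i) := by simp_rw [card_saws]

/-- **`Z⁺_n(a) ≤ a Σ_{j ≤ n} (a²-1)^j Σ_{i ≤ 2j} c_{n+i}`** for `a ≥ 1`: `v ≤ 2e+1`, binomial marks on the wall edges,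
and the injection `f`. [cite: Madras2017, §4.1 (proof of Theorem 2.4, eqs. (4.1)–(4.2))] -/
theorem adsZ_le_marked (n : ℕ) {a : ℝ} (ha : 1 ≤ a) :
    adsZ n a ≤ a * ∑ j ∈ Finset.range (n + 1), (a ^ 2 - 1) ^ j *
      ∑ i ∈ Finset.range (2 * j + 1), (count 2 (n + i) : ℝ) := by
  classical
  have h0 : 0 ≤ a := zero_le_one.trans ha
  have hs : 0 ≤ a ^ 2 - 1 := by nlinarith
  -- `a^{v} ≤ a · (a²)^{e} = a · Σ_J (a²-1)^{|J|}`
  have h1 : adsZ n a ≤ a * ∑ p ∈ markedPairs n, (a ^ 2 - 1) ^ p.2.card := by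
    rw [markedPairs, Finset.sum_sigma, adsZ, Finset.mul_sum]
    refine Finset.sum_le_sum fun ω hω => ?_
    rw [← add_pow_card_wallEdges, show (1 : ℝ) + (a ^ 2 - 1) = a ^ 2 by ring, ← pow_mul, ← pow_succ']
    exact pow_le_pow_right₀ ha (by have := wallVisits_le_two_mul_card_wallEdges_add_one hω; omega)
  refine h1.trans (mul_le_mul_of_nonneg_left ?_ h0)
  -- group the marked pairs by the number of marks `j ≤ n`
  rw [← Finset.sum_fiberwise_of_maps_to (s := markedPairs n) (t := Finset.range (n + 1)) (g := fun p => p.2.card)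
    (fun p hp => Finset.mem_range.2 (Nat.lt_succ_of_le ((Finset.card_le_card (mem_markedPairs.1 hp).2).trans
      (card_wallEdges_le n _))))]
  refine Finset.sum_le_sum fun j _ => ?_
  have heq : ∑ p ∈ (markedPairs n).filter (fun p => p.2.card = j), (a ^ 2 - 1) ^ p.2.card =
      ((markedPairs n).filter (fun p => p.2.card = j)).card * (a ^ 2 - 1) ^ j := by
    rw [Finset.sum_congr rfl fun p hp => by rw [(Finset.mem_filter.1 hp).2], Finset.sum_const, nsmul_eq_mul]
  rw [heq, mul_comm]
  refine mul_le_mul_of_nonneg_left ?_ (pow_nonneg hs _)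
  exact_mod_cast card_markedPairs_filter_le n j

end Literature.Probability.RandomPlanarGeometry.SAW.Zd
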